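import Summits.CriticalPhenomena.Ising3DConformalLimit.Theses.EnergyNotSigmaSquared
import Summits.CriticalPhenomena.Ising3DConformalLimit.Theorems.EnergyNotSigmaSquaredGapForcesFarMergingReduction
import Summits.CriticalPhenomena.Ising3DConformalLimit.Theorems.GapForcesFarMerging.Negative.NotRP
import Summits.CriticalPhenomena.Ising3DConformalLimit.Theorems.EnergyNotSigmaSquaredGapForcesFarMergingScreeningDefs
import Summits.CriticalPhenomena.Ising3DConformalLimit.Theorems.EnergyNotSigmaSquaredGapForcesFarMergingScreeningDefsUnpin
import Summits.CriticalPhenomena.Ising3DConformalLimit.Theorems.EnergyNotSigmaSquaredGapForcesFarMergingScreeningDefsAnnular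
import Summits.CriticalPhenomena.Ising3DConformalLimit.Theorems.EnergyNotSigmaSquaredGapForcesFarMergingScreeningDecayDyadic
import Summits.CriticalPhenomena.Ising3DConformalLimit.Theorems.EnergyNotSigmaSquaredGapForcesFarMergingScreeningOpaqueStep
import Summits.CriticalPhenomena.Ising3DConformalLimit.Theorems.EnergyNotSigmaSquaredGapForcesFarMergingScreeningIdentity
import Summits.CriticalPhenomena.Ising3DConformalLimit.Theorems.EnergyNotSigmaSquaredGapForcesFarMergingScreeningDecay
import Summits.CriticalPhenomena.Ising3DConformalLimit.Theorems.EnergyNotSigmaSquaredGapForcesFarMergingScreeningFarMerging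
import Summits.CriticalPhenomena.Ising3DConformalLimit.Theorems.EnergyNotSigmaSquaredGapForcesFarMergingRootOpacity
import Summits.CriticalPhenomena.Ising3DConformalLimit.Theorems.EnergyNotSigmaSquaredGapForcesFarMergingFloorsNecessity
import Summits.CriticalPhenomena.Ising3DConformalLimit.Theorems.EnergyNotSigmaSquaredGapForcesFarMergingHazardRelocationReduction
import Literature.Probability.LatticeModels.SourcedDoubleCurrentsSwitching
import Literature.Probability.LatticeModels.CurrentsPartialMonotonicity
import Literature.Probability.LatticeModels.CriticalTwoPointBounds
import Literature.Probability.Percolation.ConstrainedClusters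
import Summits.CriticalPhenomena.Ising3DConformalLimit.Theorems.EnergyNotSigmaSquaredGapForcesFarMergingScreeningUnpinGlue
import Summits.CriticalPhenomena.Ising3DConformalLimit.Theorems.EnergyNotSigmaSquaredGapForcesFarMergingScreeningNearSourceReduction

/-!
# Line `screening-form-lemma-a1`, reshaped far end (lead seat a1): the ANNULAR glue certificate
(crux `GapForcesFarMerging`, item stmt-CriticalPhenomena-4468, route `EnergyNotSigmaSquared`; lead seat a1
`prover-line-stmt-CriticalPhenomena-4468-a1-0`; helper file registered as the sub-goal
`gapForcesFarMerging_of_annular : AnnularDomination → NearSourceInsensitivity → FarSourceInsensitivity → GapForcesFarMerging`)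

This is the sorry-free part of the registered skeleton v3.1 (`Cruxes/GapForcesFarMerging/Lines/screening_form_lemma_a1.lean`):
with the landed stubs `stub_screeningIdentity` (S0, p87176), `singlePinchLawShape_of_gap` (S1), `stub_decayDyadic` (p138654),
`stub_opaqueStep` (p138973) and `stub_farMerging` (S7, p85926), the crux
`GapForcesFarMerging = EnergyGapPowerLaw → FarMergingShape cc2 (criticalCorr 3 4)` follows from the three currencies of
`Theorems/EnergyNotSigmaSquaredGapForcesFarMergingScreeningDefsAnnular.lean` alone:

```
GAP ─S1→ OnePinchGap ─S2dy(+S0)→ OnePinchScreeningDecayDyadic ─S3′→ OpaqueStepIO ─AD→ untilted annular screening drop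
    (pinned probe) ─NS→ (deep-source probe 2^{k-j}u) ─FS→ (far ends at aspect ≤ 2^{A+3}) ─antitonicity→ FarScreeningIO ─S7(+S0)→ FarMerging
```

* the FAR END is exact and proved here: pointwise `screenWeight n n 0 a b ≤ annWeight n k 0 a b` and `≤ outerWeight n K 0 a b`
  (Griffiths antitonicity of the screening ratio in the obstacle, `floorsNec_screening_anti`; the junk branch `a ∈ C` is
  handled by GKS I), integrated against the one-strand box law (`meanScreening_le_annScreen`, `meanScreening_le_outerScreen`);
* the GLUE `farScreening_of_annular : AnnularDomination → NearSourceInsensitivity → FarSourceInsensitivity → OpaqueStepIO →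
  FarScreeningIO` is filter bookkeeping + a pigeonhole over the finite family of shapes `unpinShape 2^{j+s} u`, `u ∈ F`,
  `s ≤ A + 3`, dilated by `L = 2^{k-j}`;
* `gapForcesFarMerging_of_annular` composes it with the landed stubs: the crux is CLOSED MODULO
  `AnnularDomination ∧ NearSourceInsensitivity ∧ FarSourceInsensitivity` (three statements about the box laws
  `sourcedDoubleCurrentLaw 3 n β_c` and depleted box two-point functions; v2's residual was `Floors ∧ HazardRelocation ∧ Unpin`).
-/

noncomputable section

namespace Summit.CriticalPhenomena.Ising3DConformalLimit.EnergyNotSigmaSquaredGapForcesFarMerging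

open scoped symmDiff ENNReal
open MeasureTheory Filter Finset
open Literature.Probability.LatticeModels Literature.Probability.Percolation
open Summit.CriticalPhenomena.Ising3DConformalLimit.Theses.EnergyNotSigmaSquared
open Summit.CriticalPhenomena.Ising3DConformalLimit.Theorems.GapForcesFarMerging.Negative
  (e₁ e₂ cc2 xR up dn FarMergingShape SinglePinchLawShape)
open Summit.CriticalPhenomena.Ising3DConformalLimit.GapForcesFarMergingScreening

/-! ## The far end: screening by the full cluster is at most screening by a sub-obstacle (sorry-free) -/

/-- A point off the full cluster is off every explored cluster. [folklore] -/
theorem not_mem_innerCluster_of_not_mem {r : ℕ} {b o : Site 3} {ω : BondConfig (Site 3)} (hb : b ∉ openCluster ω o) :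
    b ∉ innerCluster r o ω := fun h => hb (innerCluster_subset_openCluster r o ω _ h)

/-- **The junk branch of the depleted box two-point function is harmless**: with the first point OUTSIDE the free region
`R` the frozen outside spin is `+1`, so `⟨σ_aσ_b⟩^∅_R = ⟨σ_b⟩^∅_R ≥ 0` (GKS I). [cite: FriedliVelenik2017, Theorem 3.20] -/
theorem isingTwoPoint_free_nonneg_of_notMem {R : Finset (Site 3)} {β : ℝ} (hβ : 0 ≤ β) {a b : Site 3}
    (ha : a ∉ R) (hb : b ∈ R) : 0 ≤ isingTwoPoint (zdGraph 3) R β 0 .free a b := by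
  have key : isingTwoPoint (zdGraph 3) R β 0 .free a b = isingCorr (zdGraph 3) R β 0 .free {b} := by
    unfold isingTwoPoint isingCorr isingExpect
    rw [integral_isingMeasure (zdGraph 3) R β 0 .free (measurable_spinPair a b),
      integral_isingMeasure (zdGraph 3) R β 0 .free (measurable_spinProduct {b})]
    congr 1
    refine Finset.sum_congr rfl fun τ _ => ?_
    congr 1
    simp [spinPair, spinProduct, spinAt, glue_apply_of_notMem R τ _ ha, BoundaryCondition.outside]
  rw [key]
  exact GKSInequalities.gks_one_holds (zdGraph 3) hβ le_rfl (Or.inl rfl) (Finset.singleton_subset_iff.2 hb)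

/-- `0 ≤ S⁽ⁿ⁾_{ab}(T)` for `a ∈ Λ_n` (possibly INSIDE the obstacle — the junk branch) and `b ∈ Λ_n ∖ T`. [cite: FriedliVelenik2017, Theorem 3.20] -/
theorem screening_nonneg_of_mem {n : ℕ} {T : Finset (Site 3)} {a b : Site 3} (han : a ∈ box 3 n)
    (hb : b ∈ box 3 n \ T) : 0 ≤ screening n T a b := by
  by_cases haT : a ∈ T
  · unfold screening
    refine div_nonneg ?_ (floorsRed_boxTwoPoint_nonneg
      (Finset.mem_sdiff.2 ⟨han, Finset.notMem_empty a⟩)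
      (Finset.mem_sdiff.2 ⟨(Finset.mem_sdiff.1 hb).1, Finset.notMem_empty b⟩))
    unfold boxTwoPoint
    exact isingTwoPoint_free_nonneg_of_notMem (criticalBeta_nonneg 3)
      (fun h => (Finset.mem_sdiff.1 h).2 haT) hb
  · exact floorsRed_screening_nonneg (Finset.mem_sdiff.2 ⟨han, haT⟩) hb

/-- **Far end, pointwise (annular)**: `𝟙[a,b ∉ C]·S(C_n(0)) ≤ 𝟙[b ∉ C]·S(C_{2^{k+1}}(0) ∖ Λ_{2^k})` for `a, b ∈ Λ_n`, `2^{k+1} ≤ n`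
(Griffiths antitonicity of the screening ratio in the obstacle — the annular piece is a sub-obstacle of the full explored
cluster — off `{a ∈ C}`; on `{a ∈ C}` the left side vanishes and the right side is `≥ 0` even on its junk branch). [cite: FriedliVelenik2017, Exercise 3.12] -/
theorem screenWeight_le_annWeight {n k : ℕ} {a b : Site 3} (hk : 2 ^ (k + 1) ≤ n)
    (han : a ∈ box 3 n) (hbn : b ∈ box 3 n) (ω : BondConfig (Site 3)) :
    screenWeight n n 0 a b ω ≤ annWeight n k 0 a b ω := by
  classical
  unfold screenWeight annWeight
  by_cases hb : b ∈ openCluster ω 0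
  · simp [hb]
  · rw [if_neg hb]
    have hbT : b ∉ annPiece k 0 ω := fun h =>
      not_mem_innerCluster_of_not_mem hb ((Finset.mem_sdiff.1 h).1)
    by_cases ha' : a ∈ openCluster ω 0
    · rw [if_pos (Or.inl ha')]
      exact screening_nonneg_of_mem han (Finset.mem_sdiff.2 ⟨hbn, hbT⟩)
    · rw [if_neg (not_or.2 ⟨ha', hb⟩)]
      have hsub : annPiece k 0 ω ⊆ innerCluster n 0 ω :=
        (Finset.sdiff_subset).trans (floorsNec_innerCluster_mono hk 0 ω)
      exact floorsNec_screening_anti hsub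
        (Finset.mem_sdiff.2 ⟨han, not_mem_innerCluster_of_not_mem ha'⟩)
        (Finset.mem_sdiff.2 ⟨hbn, not_mem_innerCluster_of_not_mem hb⟩)

/-- **Far end, pointwise (outer)**: `𝟙[a,b ∉ C]·S(C_n(0)) ≤ 𝟙[b ∉ C]·S(C_n(0) ∖ Λ_{2^K})` for `a, b ∈ Λ_n`. [cite: FriedliVelenik2017, Exercise 3.12] -/
theorem screenWeight_le_outerWeight {n K : ℕ} {a b : Site 3} (han : a ∈ box 3 n)
    (hbn : b ∈ box 3 n) (ω : BondConfig (Site 3)) :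
    screenWeight n n 0 a b ω ≤ outerWeight n K 0 a b ω := by
  classical
  unfold screenWeight outerWeight
  by_cases hb : b ∈ openCluster ω 0
  · simp [hb]
  · rw [if_neg hb]
    have hbT : b ∉ outerPiece n K 0 ω := fun h =>
      not_mem_innerCluster_of_not_mem hb ((Finset.mem_sdiff.1 h).1)
    by_cases ha' : a ∈ openCluster ω 0
    · rw [if_pos (Or.inl ha')]
      exact screening_nonneg_of_mem han (Finset.mem_sdiff.2 ⟨hbn, hbT⟩)
    · rw [if_neg (not_or.2 ⟨ha', hb⟩)]
      exact floorsNec_screening_anti (Finset.sdiff_subset)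
        (Finset.mem_sdiff.2 ⟨han, not_mem_innerCluster_of_not_mem ha'⟩)
        (Finset.mem_sdiff.2 ⟨hbn, not_mem_innerCluster_of_not_mem hb⟩)

/-- **Far end, integrated (annular)**: `meanScreening n n 0 x a b ≤ annScreen n k 0 x a b` for `x, a, b ∈ Λ_n`,
`2^{k+1} ≤ n`. [cite: AizenmanDuminilCopinAnnals2021, Appendix A, Corollary A.2] -/
theorem meanScreening_le_annScreen {n k : ℕ} {x a b : Site 3} (hx : x ∈ box 3 n) (hk : 2 ^ (k + 1) ≤ n)
    (han : a ∈ box 3 n) (hbn : b ∈ box 3 n) :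
    meanScreening n n 0 x a b ≤ annScreen n k 0 x a b := by
  haveI := floorsRed_isProbabilityMeasure (n := n) hx
  exact integral_mono (floorsRed_integrable _ (floorsRed_abs_screenWeight_le n n 0 a b))
    (floorsRed_integrable _ (nearSrc_abs_annWeight_le n k 0 a b)) fun ω => screenWeight_le_annWeight hk han hbn ω

/-- **Far end, integrated (outer)**: `meanScreening n n 0 x a b ≤ outerScreen n K 0 x a b` for `x, a, b ∈ Λ_n`. [cite: AizenmanDuminilCopinAnnals2021, Appendix A, Corollary A.2] -/
theorem meanScreening_le_outerScreen {n K : ℕ} {x a b : Site 3} (hx : x ∈ box 3 n)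
    (han : a ∈ box 3 n) (hbn : b ∈ box 3 n) :
    meanScreening n n 0 x a b ≤ outerScreen n K 0 x a b := by
  haveI := floorsRed_isProbabilityMeasure (n := n) hx
  exact integral_mono (floorsRed_integrable _ (floorsRed_abs_screenWeight_le n n 0 a b))
    (floorsRed_integrable _ (nearSrc_abs_outerWeight_le n K 0 a b)) fun ω => screenWeight_le_outerWeight han hbn ω


/-! ## Glue of the reshaped far end: `AD → NS → FS → OpaqueStepIO → FarScreeningIO` -/

/-- Dilating a point of `Λ_a` by `L` lands in `Λ_{aL}`. [folklore] -/
theorem zsmul_mem_box {a L : ℕ} {u : Site 3} (hu : u ∈ box 3 a) : ((L : ℤ)) • u ∈ box 3 (a * L) := by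
  rw [mem_box] at hu ⊢
  intro i
  obtain ⟨h1, h2⟩ := hu i
  have hL : (0 : ℤ) ≤ L := by positivity
  rw [Pi.smul_apply, zsmul_eq_mul]
  push_cast
  constructor <;> nlinarith

/-- Eventually in `n`: `up M, dn M ∈ Λ_n`, `2^{k+1} ≤ n`, and every deep source `2^{k-j}u`, `u ∈ F` (finite), lies in `Λ_n`. [folklore] -/
theorem eventually_mem_boxes (M k j : ℕ) (F : Finset (Site 3)) :
    ∀ᶠ n : ℕ in atTop, up M ∈ box 3 n ∧ dn M ∈ box 3 n ∧ 2 ^ (k + 1) ≤ n ∧ ∀ u ∈ F, deepSource k j u ∈ box 3 n := by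
  obtain ⟨L₀, hL₀⟩ := exists_forall_subset_box 3 F
  filter_upwards [eventually_ge_atTop (2 * M + 1), eventually_ge_atTop (2 ^ (k + 1)),
    eventually_ge_atTop (L₀ * 2 ^ (k - j))] with n hn hn' hn''
  obtain ⟨hup, -, hdn⟩ := floorsRed_mem_box hn
  refine ⟨hup, hdn, hn', fun u hu => ?_⟩
  exact box_mono 3 hn'' (zsmul_mem_box (hL₀ L₀ le_rfl hu))

/-- **Glue of the reshaped far end** `AnnularDomination → NearSourceInsensitivity → FarSourceInsensitivity → OpaqueStepIO →
FarScreeningIO`: at an opaque step (octave `k < K` or bulk `K`) annular domination gives an untilted annular (outer) screening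
drop `μ` of the pinned probe; near-source insensitivity moves the probe source to a deep interior point `2^{k-j}u`, `u ∈ F`;
if the octave sits more than `A` octaves below the far scale, far-source insensitivity moves both far ends to `2^{k+A+3}`;
screening by the full cluster is at most screening by the sub-obstacle (far end, exact); pigeonhole over the finite family
`F × {3,…,A+3}` of shapes `unpinShape 2^{j+s} u` dilated by `L = 2^{k-j}`. Filters only. [folklore] -/
theorem farScreening_of_annular :
    AnnularDomination → NearSourceInsensitivity → FarSourceInsensitivity → OpaqueStepIO → FarScreeningIO := by
  intro hAD hNS hFS hO
  obtain ⟨c, hc, hO⟩ := hO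
  obtain ⟨μ, hμ, hADo, hADb⟩ := hAD c hc
  obtain ⟨j, F, -, hF, hNSo, hNSb⟩ := hNS μ hμ
  obtain ⟨A, hFSo⟩ := hFS (μ / 2) (half_pos hμ) j F
  -- Step 1: beyond every `k₀`, a scale `k`, a point `u ∈ F` and an exponent `s < A + 4` with far screening `≤ 1 - μ/4`, i.o. in `n`
  have key : ∀ k₀ : ℕ, ∃ k : ℕ, k₀ ≤ k ∧ ∃ p ∈ F ×ˢ Finset.range (A + 4), ∃ᶠ n : ℕ in atTop,
      meanScreening n n 0 (up (2 ^ (k + p.2))) (deepSource k j p.1) (dn (2 ^ (k + p.2))) ≤ 1 - μ / 4 := by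
    intro k₀
    obtain ⟨k₁, hk₁⟩ := Filter.eventually_atTop.1 hADo
    obtain ⟨k₂, hk₂⟩ := Filter.eventually_atTop.1 hNSo
    obtain ⟨k₃, hk₃⟩ := Filter.eventually_atTop.1 hFSo
    obtain ⟨K₁, hK₁⟩ := Filter.eventually_atTop.1 hADb
    obtain ⟨K₂, hK₂⟩ := Filter.eventually_atTop.1 hNSb
    obtain ⟨K, hK, hcase⟩ := hO (k₀ + j + k₁ + k₂ + k₃ + K₁ + K₂)
    rcases hcase with ⟨k, hk, hkK, hfr⟩ | hfr
    · -- octave step `k < K`, far scale `2^{K+3}`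
      have hA1 := hk₁ k (by omega) K hkK
      have hN1 := hk₂ k (by omega) K hkK
      by_cases hKA : k + A ≤ K
      · -- far ends relocated to `2^{k+A+3}` (`s = A + 3`)
        have hF1 := hk₃ k (by omega) K hKA
        have hmem := eventually_mem_boxes (2 ^ (k + A + 3)) k j F
        have hfin : ∃ᶠ n : ℕ in atTop, ∃ u ∈ F,
            meanScreening n n 0 (up (2 ^ (k + (A + 3)))) (deepSource k j u) (dn (2 ^ (k + (A + 3)))) ≤ 1 - μ / 4 := by
          refine (hfr.and_eventually (hA1.and (hN1.and (hF1.and hmem)))).mono ?_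
          rintro n ⟨hdrop, hA1n, hN1n, hF1n, hup, hdn, hkn, hdeep⟩
          obtain ⟨u, huF, hu⟩ := hN1n (hA1n hdrop)
          refine ⟨u, huF, ?_⟩
          rw [← add_assoc]
          calc meanScreening n n 0 (up (2 ^ (k + A + 3))) (deepSource k j u) (dn (2 ^ (k + A + 3)))
              ≤ annScreen n k 0 (up (2 ^ (k + A + 3))) (deepSource k j u) (dn (2 ^ (k + A + 3))) :=
                meanScreening_le_annScreen hup hkn (hdeep u huF) hdn
            _ ≤ 1 - μ / 2 / 2 := hF1n u huF hu
            _ = 1 - μ / 4 := by ring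
        obtain ⟨u, huF, hfu⟩ := frequently_exists_mem_finset hfin
        exact ⟨k, by omega, (u, A + 3), Finset.mem_product.2 ⟨huF, Finset.mem_range.2 (by omega)⟩, hfu⟩
      · -- far scale already at bounded aspect: `2^{K+3} = 2^{k+s}`, `s ≤ A + 2`
        push Not at hKA
        obtain ⟨s, hs⟩ : ∃ s : ℕ, K + 3 = k + s := ⟨K + 3 - k, by omega⟩
        have hmem := eventually_mem_boxes (2 ^ (K + 3)) k j F
        have hfin : ∃ᶠ n : ℕ in atTop, ∃ u ∈ F,
            meanScreening n n 0 (up (2 ^ (k + s))) (deepSource k j u) (dn (2 ^ (k + s))) ≤ 1 - μ / 4 := by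
          refine (hfr.and_eventually (hA1.and (hN1.and hmem))).mono ?_
          rintro n ⟨hdrop, hA1n, hN1n, hup, hdn, hkn, hdeep⟩
          obtain ⟨u, huF, hu⟩ := hN1n (hA1n hdrop)
          refine ⟨u, huF, ?_⟩
          rw [← hs]
          calc meanScreening n n 0 (up (2 ^ (K + 3))) (deepSource k j u) (dn (2 ^ (K + 3)))
              ≤ annScreen n k 0 (up (2 ^ (K + 3))) (deepSource k j u) (dn (2 ^ (K + 3))) :=
                meanScreening_le_annScreen hup hkn (hdeep u huF) hdn
            _ ≤ 1 - μ / 2 := hu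
            _ ≤ 1 - μ / 4 := by linarith
        obtain ⟨u, huF, hfu⟩ := frequently_exists_mem_finset hfin
        exact ⟨k, by omega, (u, s), Finset.mem_product.2 ⟨huF, Finset.mem_range.2 (by omega)⟩, hfu⟩
    · -- bulk step at `K`, far scale `2^{K+3}` (`k = K`, `s = 3`)
      have hA1 := hK₁ K (by omega)
      have hN1 := hK₂ K (by omega)
      have hmem := eventually_mem_boxes (2 ^ (K + 3)) K j F
      have hfin : ∃ᶠ n : ℕ in atTop, ∃ u ∈ F,
          meanScreening n n 0 (up (2 ^ (K + 3))) (deepSource K j u) (dn (2 ^ (K + 3))) ≤ 1 - μ / 4 := by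
        refine (hfr.and_eventually (hA1.and (hN1.and hmem))).mono ?_
        rintro n ⟨hdrop, hA1n, hN1n, hup, hdn, -, hdeep⟩
        obtain ⟨u, huF, hu⟩ := hN1n (hA1n hdrop)
        refine ⟨u, huF, ?_⟩
        calc meanScreening n n 0 (up (2 ^ (K + 3))) (deepSource K j u) (dn (2 ^ (K + 3)))
            ≤ outerScreen n K 0 (up (2 ^ (K + 3))) (deepSource K j u) (dn (2 ^ (K + 3))) :=
              meanScreening_le_outerScreen hup (hdeep u huF) hdn
          _ ≤ 1 - μ / 2 := hu
          _ ≤ 1 - μ / 4 := by linarith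
      obtain ⟨u, huF, hfu⟩ := frequently_exists_mem_finset hfin
      exact ⟨K, by omega, (u, 3), Finset.mem_product.2 ⟨huF, Finset.mem_range.2 (by omega)⟩, hfu⟩
  -- Step 2: pigeonhole over the finite family of shapes
  have hfreqk : ∃ᶠ k : ℕ in atTop, ∃ p ∈ F ×ˢ Finset.range (A + 4), ∃ᶠ n : ℕ in atTop,
      meanScreening n n 0 (up (2 ^ (k + p.2))) (deepSource k j p.1) (dn (2 ^ (k + p.2))) ≤ 1 - μ / 4 :=
    Filter.frequently_atTop.2 fun k₀ => key k₀
  obtain ⟨p, hp, hpk⟩ := frequently_exists_mem_finset hfreqk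
  rcases p with ⟨u, s⟩
  obtain ⟨huF, -⟩ := Finset.mem_product.1 hp
  -- Step 3: read off `FarScreeningIO` for the shape `unpinShape 2^{j+s} u` along `L = 2^{k-j}`
  refine ⟨μ / 4, by positivity, unpinShape (2 ^ (j + s)) u,
    unpinShape_injective_of_ne u (hF u huF) _ Nat.one_le_two_pow, fun L₀ => ?_⟩
  obtain ⟨k, hkL, hkn⟩ := (Filter.frequently_atTop.1 hpk) (j + L₀)
  refine ⟨2 ^ (k - j), ?_, ?_⟩
  · calc L₀ ≤ k - j := by omega
      _ ≤ 2 ^ (k - j) := Nat.lt_two_pow_self.le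
  · obtain ⟨h0, h1, h2, h3⟩ := zsmul_unpinShape (2 ^ (j + s)) (2 ^ (k - j)) u
    have hpow : 2 ^ (j + s) * 2 ^ (k - j) = 2 ^ (k + s) := by
      rw [← pow_add]; congr 1; omega
    rw [h0, h1, h2, h3, hpow]
    exact hkn


/-! ## The registered stubs of the reshaped skeleton (v3) -/


/-! ## The certificate: the crux BY NAME from the three currencies and the landed stubs -/

/-- **The annular certificate** — `AnnularDomination → NearSourceInsensitivity → FarSourceInsensitivity → GapForcesFarMerging`:
GAP is un-pinched by the landed RP halving (`singlePinchLawShape_of_gap`), read as dyadic screening decay (`stub_decayDyadic`,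
with the dictionary `stub_screeningIdentity`), turned into one opaque step beyond every octave (`stub_opaqueStep`), transferred
to far screening of a fixed dilated shape by the glue above, and returned to spins by Lemma A.1 (`stub_farMerging`). [folklore] -/
theorem gapForcesFarMerging_of_annular :
    AnnularDomination → NearSourceInsensitivity → FarSourceInsensitivity → GapForcesFarMerging := by
  intro hAD hNS hFS hgap
  have h₁ : OnePinchGap := singlePinchLawShape_of_gap hgap
  exact stub_farMerging stub_screeningIdentity
    (farScreening_of_annular hAD hNS hFS (stub_opaqueStep (stub_decayDyadic stub_screeningIdentity h₁)))

/-- The same certificate with the crux spelled by its fully-qualified route name. [folklore] -/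
theorem gapForcesFarMerging_of_annular' (hAD : AnnularDomination) (hNS : NearSourceInsensitivity)
    (hFS : FarSourceInsensitivity) :
    Summit.CriticalPhenomena.Ising3DConformalLimit.Theses.EnergyNotSigmaSquared.GapForcesFarMerging :=
  gapForcesFarMerging_of_annular hAD hNS hFS

end Summit.CriticalPhenomena.Ising3DConformalLimit.EnergyNotSigmaSquaredGapForcesFarMerging

end
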